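import Summits.QuantumAdvantage.QuantumAdvantage.Theorems.WalkThreeStepForms
import Summits.QuantumAdvantage.QuantumAdvantage.Theorems.WalkTwoStepFarLocalFlip

/-!
# Toward rung (G♯₂) `ThreeStepFreeRungFive` (item stmt-QuantumAdvantage-23286): statuses, flip invariance and the TWO-FLIP PARITY REDUCTION

Cell qa-qnc0, route OddPrimeWalk, support item stmt-QuantumAdvantage-23286 (planner qa-qnc0-p2, P2-25b); prover qn-prover-3 g15.
The three-step analogue of `WalkTwoStepFarLocalFlip.lean` up to the point where the two-step and three-step cases diverge:
* `status3`, `status3_eq_true_iff`, `ringWinU_eq_true_iff_odd_status3`, `ringWinU_eq_true_iff_odd_sum3`;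
* `status3_cornerFlip_of_ne`: a cut observes the corner flip at `τ` only through its position or one of its TWO splits;
* `discBit3`, `fourCount3`, `xor_discBit3_iff_odd_sum`: for two commuting corner flips `φ = cornerFlip n τ₁`, `ψ = cornerFlip n τ₂`
  (`|τ₁ − τ₂| ≥ 2`), `disc u ⊕ disc (ψ u)` is the parity of `Σ_h fourCount3 h`;
* `even_fourCount3_of_unobserved`: a cut that does not observe `τ₁` (position and both splits `≠ τ₁`), or does not observe `τ₂`, has an
  EVEN four-count; hence **`xor_discBit3_iff_odd_sum_observers`**: the parity reduces to the cuts observing BOTH flip times — the flipped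
  cut, the cut sitting at `τ₂`, and (new in the three-step class) the "double co-observers" whose two splits are `{τ₁, τ₂}`.
WHAT THIS IS NOT: no per-cut product forms, no criterion, no counting; separation NOT moved.
-/

namespace Summit.QuantumAdvantage.AdviceFreeQNC0.LocalEngine

open Finset Classical

section ThreeStepFlip

variable {p n : ℕ}

/-- Status (fires and is live) of cut `h` of a three-step strategy. -/
def status3 (c : ℕ) (S : ThreeStep p n) (h : Fin (n + 1)) (u : Fin n → Bool) : Bool :=
  S.y h u && decide ((c + h.val + walkExp u h.val) % 3 ≠ 0)

/-- `status3 = true` iff the cut fires and is live. -/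
theorem status3_eq_true_iff (c : ℕ) (S : ThreeStep p n) (h : Fin (n + 1)) (u : Fin n → Bool) :
    status3 c S h u = true ↔ (S.y h u = true ∧ (c + h.val + walkExp u h.val) % 3 ≠ 0) := by
  unfold status3
  rw [Bool.and_eq_true, decide_eq_true_iff]

/-- `ringWinU` counts the cuts with `status3 = true`. -/
theorem ringWinU_eq_true_iff_odd_status3 (c : ℕ) (S : ThreeStep p n) (u : Fin n → Bool) :
    ringWinU c S.y u = true ↔ Odd ((univ.filter fun h : Fin (n + 1) => status3 c S h u = true).card) := by
  unfold ringWinU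
  rw [decide_eq_true_iff, ← Nat.odd_iff]
  have hset : (univ.filter fun h : Fin (n + 1) => S.y h u = true ∧ (c + h.val + walkExp u h.val) % 3 ≠ 0)
      = univ.filter fun h : Fin (n + 1) => status3 c S h u = true :=
    Finset.filter_congr fun h _ => (status3_eq_true_iff c S h u).symm
  rw [hset]

/-- The same parity as a sum of bits. -/
theorem ringWinU_eq_true_iff_odd_sum3 (c : ℕ) (S : ThreeStep p n) (u : Fin n → Bool) :
    ringWinU c S.y u = true ↔ Odd (∑ h : Fin (n + 1), (status3 c S h u).toNat) := by
  rw [ringWinU_eq_true_iff_odd_status3, Finset.card_filter]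
  simp only [toNat_eq_ite]

/-- **A cut observes the flip at `τ` only through its position or one of its two splits.** -/
theorem status3_cornerFlip_of_ne (c : ℕ) (S : ThreeStep p n) (h : Fin (n + 1)) (τ : ℕ) (u : Fin n → Bool)
    (h1 : h.val ≠ τ) (h2 : S.s h ≠ τ) (h3 : S.t h ≠ τ) : status3 c S h (cornerFlip n τ u) = status3 c S h u := by
  unfold status3
  rw [ThreeStep.y_cornerFlip S τ u h h2 h3, walkExp_cornerFlip τ u h1]

/-- Cut `h` OBSERVES time `τ`: it sits there or one of its splits is `τ`. -/
def Observes (S : ThreeStep p n) (h : Fin (n + 1)) (τ : ℕ) : Prop := h.val = τ ∨ S.s h = τ ∨ S.t h = τ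

/-- A non-observer's status is invariant under the flip. -/
theorem status3_cornerFlip_of_not_observes (c : ℕ) (S : ThreeStep p n) (h : Fin (n + 1)) (τ : ℕ) (u : Fin n → Bool)
    (hno : ¬ Observes S h τ) : status3 c S h (cornerFlip n τ u) = status3 c S h u := by
  unfold Observes at hno
  push Not at hno
  exact status3_cornerFlip_of_ne c S h τ u hno.1 hno.2.1 hno.2.2

/-- The discordance bit of a three-step strategy under the flip at `τ`. -/
def discBit3 (c : ℕ) (S : ThreeStep p n) (τ : ℕ) (u : Fin n → Bool) : Bool :=
  xor (ringWinU c S.y u) (ringWinU c S.y (cornerFlip n τ u))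

/-- `discBit3 = true` is the discordance predicate. -/
theorem discBit3_eq_true_iff (c : ℕ) (S : ThreeStep p n) (τ : ℕ) (u : Fin n → Bool) :
    discBit3 c S τ u = true ↔ ringWinU c S.y u ≠ ringWinU c S.y (cornerFlip n τ u) := by
  unfold discBit3
  cases ringWinU c S.y u <;> cases ringWinU c S.y (cornerFlip n τ u) <;> simp

/-- The four-input count of live firings of cut `h` under the two flips. -/
def fourCount3 (c : ℕ) (S : ThreeStep p n) (τ₁ τ₂ : ℕ) (u : Fin n → Bool) (h : Fin (n + 1)) : ℕ :=
  (status3 c S h u).toNat + (status3 c S h (cornerFlip n τ₁ u)).toNat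
    + ((status3 c S h (cornerFlip n τ₂ u)).toNat + (status3 c S h (cornerFlip n τ₁ (cornerFlip n τ₂ u))).toNat)

/-- The xor of the two discordance bits is the parity of `Σ_h fourCount3 h`. -/
theorem xor_discBit3_iff_odd_sum (c : ℕ) (S : ThreeStep p n) (τ₁ τ₂ : ℕ) (u : Fin n → Bool) :
    (xor (discBit3 c S τ₁ u) (discBit3 c S τ₁ (cornerFlip n τ₂ u)) = true) ↔
      Odd (∑ h : Fin (n + 1), fourCount3 c S τ₁ τ₂ u h) := by
  have e : ∑ h : Fin (n + 1), fourCount3 c S τ₁ τ₂ u h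
      = (∑ h : Fin (n + 1), (status3 c S h u).toNat + ∑ h : Fin (n + 1), (status3 c S h (cornerFlip n τ₁ u)).toNat)
        + (∑ h : Fin (n + 1), (status3 c S h (cornerFlip n τ₂ u)).toNat
          + ∑ h : Fin (n + 1), (status3 c S h (cornerFlip n τ₁ (cornerFlip n τ₂ u))).toNat) := by
    unfold fourCount3
    rw [Finset.sum_add_distrib, Finset.sum_add_distrib, Finset.sum_add_distrib]
  rw [e]
  unfold discBit3
  exact xor_eq_true_iff_odd_add
    (xor_eq_true_iff_odd_add (ringWinU_eq_true_iff_odd_sum3 c S u) (ringWinU_eq_true_iff_odd_sum3 c S _))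
    (xor_eq_true_iff_odd_add (ringWinU_eq_true_iff_odd_sum3 c S _) (ringWinU_eq_true_iff_odd_sum3 c S _))

/-- **A cut that fails to observe one of the two (commuting) flip times has an even four-count.** -/
theorem even_fourCount3_of_unobserved (c : ℕ) (S : ThreeStep p n) {τ₁ τ₂ : ℕ} (hτ : τ₁ + 2 ≤ τ₂ ∨ τ₂ + 2 ≤ τ₁)
    (u : Fin n → Bool) (h : Fin (n + 1)) (hno : ¬ Observes S h τ₁ ∨ ¬ Observes S h τ₂) :
    Even (fourCount3 c S τ₁ τ₂ u h) := by
  unfold fourCount3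
  rcases hno with hno | hno
  · -- invariant under the flip at `τ₁`
    rw [status3_cornerFlip_of_not_observes c S h τ₁ u hno, status3_cornerFlip_of_not_observes c S h τ₁ _ hno]
    exact even_twoPairs (status3 c S h u) (status3 c S h (cornerFlip n τ₂ u))
  · -- invariant under the flip at `τ₂` (using commutation for the fourth input)
    rw [status3_cornerFlip_of_not_observes c S h τ₂ u hno, cornerFlip_comm hτ u,
      status3_cornerFlip_of_not_observes c S h τ₂ _ hno]
    obtain ⟨k, hk⟩ := even_twoPairs (status3 c S h u) (status3 c S h (cornerFlip n τ₁ u))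
    exact ⟨k, by omega⟩

/-- Parity reduction to a subset: if the summands off `O` are even, the parity of the full sum is that of the sum over `O`. -/
theorem odd_sum_univ_iff_odd_sum_filter {m : ℕ} (t : Fin m → ℕ) (O : Finset (Fin m))
    (heven : ∀ h, h ∉ O → Even (t h)) :
    Odd (∑ h : Fin m, t h) ↔ Odd (∑ h ∈ O, t h) := by
  have e := Finset.sum_add_sum_compl O t
  have hrest : Even (∑ h ∈ Oᶜ, t h) := by
    apply Finset.even_sum
    intro h hh
    exact heven h (Finset.mem_compl.mp hh)
  rw [← e, Nat.odd_add]
  constructor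
  · intro h'; exact h'.mpr hrest
  · intro h'; exact ⟨fun _ => hrest, fun _ => h'⟩

/-- **Two-flip parity reduction for three-step strategies.**  With `φ`, `ψ` the corner flips at `τ₁`, `τ₂` (`|τ₁ − τ₂| ≥ 2`),
`disc u ⊕ disc (ψ u)` is the parity of the four-counts of the cuts observing BOTH times (position or a split at `τ₁`, AND position or
a split at `τ₂`).  In the two-step class these are the flipped cut and its mirror; here also the cuts with splits `{τ₁, τ₂}`. -/
theorem xor_discBit3_iff_odd_sum_observers (c : ℕ) (S : ThreeStep p n) {τ₁ τ₂ : ℕ} (hτ : τ₁ + 2 ≤ τ₂ ∨ τ₂ + 2 ≤ τ₁)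
    (u : Fin n → Bool) :
    (xor (discBit3 c S τ₁ u) (discBit3 c S τ₁ (cornerFlip n τ₂ u)) = true) ↔
      Odd (∑ h ∈ univ.filter (fun h : Fin (n + 1) => Observes S h τ₁ ∧ Observes S h τ₂), fourCount3 c S τ₁ τ₂ u h) := by
  rw [xor_discBit3_iff_odd_sum]
  apply odd_sum_univ_iff_odd_sum_filter
  intro h hh
  rw [Finset.mem_filter, not_and_or] at hh
  rcases hh with hh | hh
  · exact absurd (Finset.mem_univ h) hh
  · rw [not_and_or] at hh
    exact even_fourCount3_of_unobserved c S hτ u h hh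

end ThreeStepFlip

end Summit.QuantumAdvantage.AdviceFreeQNC0.LocalEngine
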